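import Summits.ValiantsHypothesis.ValiantsHypothesis.Theses.LacunarySymmetroid
import Summits.ValiantsHypothesis.ValiantsHypothesis.Theorems.LacunarySymmetroidThetaWitness

/-!
# `LacunarySymmetroid.PencilTransfer`: the p-computability clause is load-bearing modulo `MatrixDescartes`

Negative (load-bearing) lemma for the crux `PencilTransfer` (item stmt-ValiantsHypothesis-18051, route
`LacunarySymmetroid`), filed by the crux-disprover seat.

`IsVPFamily g = IsPFamily g ∧ IsPComputable g`. Weaken the hypothesis of `PencilTransfer` from
`IsVPFamily (f ⊗ ℂ)` to `IsPFamily (f ⊗ ℂ)` (drop p-computability, keep the variable and degree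
bounds) and keep the conclusion verbatim. The resulting statement is FALSE as soon as the route's other
crux `MatrixDescartes` holds: the witness of `ThetaWitness`, now PROVED in tree (`thetaWitness_proof`:
a real family `Θ_n` in `n` variables with `VNP` complexification and `≥ 2^{n⌊log₂ n⌋} - 1` distinct
real zeros along a monomial curve), is a `VNP` family and therefore a p-family (`IsVNPFamily.1`), so
the complexity-free transfer applies to it WITHOUT the assumption `VP = VNP`, and the assembly
arithmetic of `LacunarySymmetroid.closes` (isolated below as `matrixDescartes_contradiction`) ends in
`False`.

Reading for provers: any proof of `PencilTransfer` must use `IsPComputable (f ⊗ ℂ)` unless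
`MatrixDescartes` is false — a complexity-free argument would refute the route's rank-2 crux
(contrapositive of the theorem below). Unconditionally the complexity-free
variant is an open MDR-type question and is not decided here.
-/

-- `Summit.ValiantsHypothesis.ValiantsHypothesis.…` is the tree's mandated single-conjunct layout
-- (Sub = Summit), so the duplicated namespace component is intended.
set_option linter.dupNamespace false

namespace Summit.ValiantsHypothesis.ValiantsHypothesis.Theorems.PencilTransfer.Negative

open Polynomial Literature.Computability.AlgebraicComplexity
open Summit.ValiantsHypothesis.ValiantsHypothesis.Theses.LacunarySymmetroid

/-- **The assembly arithmetic of `closes`, isolated.** `MatrixDescartes`, a family `Θ_n` in `n`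
variables with eventually `≥ 2^{n⌊log₂ n⌋} - 1` distinct real zeros along the curve `y_i = X^{d_{n,i}}`,
and transferred symmetric pencils for `(Θ, d)` of size `≤ 2^((log₂ n + c)^c)` with the same real zero
sets are contradictory: at `n = n₀ + K₀ + 4`, `Z⁴ ≤ 2^{(n+1)(L+1)}` and `Z + 1 ≥ 2^{nL}` with
`L = ⌊log₂ n⌋ ≥ 2` force `3nL ≤ n + L + 5`, false (verbatim tail of `LacunarySymmetroid.closes`). [folklore] -/
theorem matrixDescartes_contradiction (hMDR : MatrixDescartes) {Θ : ∀ n : ℕ, MvPolynomial (Fin n) ℝ}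
    {d : ∀ n : ℕ, Fin n → ℕ} {n₀ : ℕ}
    (hroots : ∀ n : ℕ, n₀ ≤ n → 2 ^ (n * Nat.log 2 n) ≤
      (MvPolynomial.aeval (fun i => (Polynomial.X : Polynomial ℝ) ^ d n i) (Θ n)).roots.toFinset.card + 1)
    {c : ℕ} (hc : ∀ n : ℕ, ∃ m : ℕ, m ≤ 2 ^ ((Nat.log 2 n + c) ^ c) ∧
      ∃ S : Fin (n + 1) → Matrix (Fin m) (Fin m) ℝ, (∀ l, (S l).IsSymm) ∧
        (Matrix.det (∑ l, ((Polynomial.X : Polynomial ℝ) ^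
            (Fin.cons (α := fun _ => ℕ) (0 : ℕ) (d n) l)) • (S l).map Polynomial.C)).roots.toFinset =
        (MvPolynomial.aeval (fun i => (Polynomial.X : Polynomial ℝ) ^ d n i) (Θ n)).roots.toFinset) :
    False := by
  obtain ⟨K₀, hK⟩ := hMDR c 4 (by norm_num)
  obtain ⟨n, hn₀, hnK, hn4⟩ : ∃ n, n₀ ≤ n ∧ K₀ ≤ n ∧ 4 ≤ n := ⟨n₀ + K₀ + 4, by omega, by omega, by omega⟩
  obtain ⟨m, hm, S, hS, hroot⟩ := hc n
  set Z := (MvPolynomial.aeval (fun i => (Polynomial.X : Polynomial ℝ) ^ d n i) (Θ n)).roots.toFinset.card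
    with hZ
  have hm' : m ≤ 2 ^ ((Nat.log 2 (n + 1) + c) ^ c) :=
    hm.trans (Nat.pow_le_pow_right (by norm_num)
      (Nat.pow_le_pow_left (Nat.add_le_add_right (Nat.log_mono_right (Nat.le_succ n)) c) c))
  have h1 := hK (n + 1) m (by omega) hm' (Fin.cons (α := fun _ => ℕ) (0 : ℕ) (d n)) S hS
  rw [hroot] at h1
  have h2 : 2 ^ (n * Nat.log 2 n) ≤ Z + 1 := hroots n hn₀
  set L := Nat.log 2 n with hL
  have hL2 : 2 ≤ L := by
    rw [hL]
    calc 2 = Nat.log 2 4 := by decide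
      _ ≤ Nat.log 2 n := Nat.log_mono_right hn4
  have hLn : L ≤ n := by rw [hL]; exact Nat.log_le_self 2 n
  have hL' : Nat.log 2 (n + 1) ≤ L + 1 := by
    rw [hL]
    calc Nat.log 2 (n + 1) ≤ Nat.log 2 (n * 2) := Nat.log_mono_right (by omega)
      _ = Nat.log 2 n + 1 := Nat.log_mul_base (by norm_num) (by omega)
  have h3 : Z ^ 4 ≤ 2 ^ ((n + 1) * (L + 1)) :=
    h1.trans (Nat.pow_le_pow_right (by norm_num) (Nat.mul_le_mul_left _ hL'))
  have hnL : 1 ≤ n * L := by nlinarith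
  have h4 : 2 ^ (n * L - 1) ≤ Z := by
    have e : 2 ^ (n * L) = 2 * 2 ^ (n * L - 1) := by
      rw [← Nat.pow_succ']
      congr 1
      omega
    have h2' := h2
    rw [e] at h2'
    have : 1 ≤ 2 ^ (n * L - 1) := Nat.one_le_two_pow
    omega
  have h5 : 2 ^ (4 * (n * L - 1)) ≤ Z ^ 4 := by
    rw [pow_mul']
    exact Nat.pow_le_pow_left h4 4
  have h6 : 4 * (n * L - 1) ≤ (n + 1) * (L + 1) :=
    (Nat.pow_le_pow_iff_right (by norm_num)).1 (h5.trans h3)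
  have h7 : 6 * n ≤ 3 * (n * L) := by nlinarith
  have h6' : 4 * (n * L - 1) ≤ n * L + n + L + 1 := by
    have e : (n + 1) * (L + 1) = n * L + n + L + 1 := by ring
    rw [e] at h6
    exact h6
  generalize hP : n * L = P at h6' h7 hnL
  omega

/-- **The p-computability clause of `IsVPFamily` is load-bearing for `PencilTransfer`, modulo
`MatrixDescartes`**: if `MatrixDescartes` holds then `PencilTransfer` with its hypothesis weakened to
`IsPFamily (f ⊗ ℂ)` (conclusion verbatim) is false — apply it to the proved `ThetaWitness` family
(`VNP`, hence a p-family) and run `matrixDescartes_contradiction`. [folklore] -/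
theorem pencilTransfer_false_without_complexityBound_of_matrixDescartes (hMDR : MatrixDescartes) :
    ¬ (∀ (v : ℕ → ℕ) (f : ∀ n, MvPolynomial (Fin (v n)) ℝ),
        IsPFamily (fun n => MvPolynomial.map (algebraMap ℝ ℂ) (f n)) →
        ∀ d : (n : ℕ) → Fin (v n) → ℕ, ∃ c : ℕ, ∀ n : ℕ, ∃ m : ℕ, m ≤ 2 ^ ((Nat.log 2 n + c) ^ c) ∧
          ∃ S : Fin (v n + 1) → Matrix (Fin m) (Fin m) ℝ, (∀ l, (S l).IsSymm) ∧
            (Matrix.det (∑ l, ((Polynomial.X : Polynomial ℝ) ^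
                (Fin.cons (α := fun _ => ℕ) (0 : ℕ) (d n) l)) • (S l).map Polynomial.C)).roots.toFinset =
            (MvPolynomial.aeval (fun i => (Polynomial.X : Polynomial ℝ) ^ d n i) (f n)).roots.toFinset) := by
  intro hT
  obtain ⟨Θ, d, hVNP, n₀, hroots⟩ :=
    Summit.ValiantsHypothesis.ValiantsHypothesis.Theorems.LacunarySymmetroid.thetaWitness_proof
  obtain ⟨c, hc⟩ := hT (fun n => n) Θ hVNP.1 d
  exact matrixDescartes_contradiction hMDR hroots hc

end Summit.ValiantsHypothesis.ValiantsHypothesis.Theorems.PencilTransfer.Negative
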